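import Summits.HodgeConjecture.HodgeConjecture.Theorems.LinearSystemTorelliLocalTubeSpanFrame

/-!
# Route LinearSystemTorelli — crux `LocalTubeSpan`: the frame theorem modulo a stable submodule

Helper file (`--supports stmt-HodgeConjecture-2490`, line `Sketch`, stub `stub_frameMod`, taken by
the line lead).  The companion file `LinearSystemTorelliLocalTubeSpanFrame` proves the formal core
of C. Schnell, *Primitive cohomology and the tube mapping*, Math. Z. 268 (2010) §7 Prop. 12 in
FRAME FORM: if `G` is generated by rank-one direction-fixing elements and contains a linearly
independent rank-one frame `u_0, …, u_{r-1}` whose subgroup `Γ'` contains a positive power of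
every generator, then Schnell's third map `H¹(G, V) → ∏_g V/(g - 1)V` is injective.

At a point of the discriminant where the local vanishing lattice `L` has a RADICAL
`R = L ∩ L^⊥` (every reducible member, e.g. `Y₁ ∪ Y₂`), the generators are virtually contained in
the frame group only up to the kernel of `Γ_loc → GL(L)`, whose elements `κ` move vectors into
`R` (`(κ - 1)V ⊆ R`).  The present file proves the form of the frame theorem that absorbs such a
kernel:

* `localTubeSpan_injective_evalCoinv_of_frame_mod` — as the frame theorem, but each generator
  `t` need only have a positive power in the subgroup generated by the frame TOGETHER WITH all
  `κ` with `(κ - 1)V ⊆ M`, for a `G`-stable submodule `M` meeting no generator line `k·e_t`.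

Proof: an undetected cocycle, adjusted by a coboundary to vanish on the frame group (Schnell's
Lemma 9 peeling, imported from the Frame file's proof pattern), takes values in `M` on the bigger
subgroup — `{g | φ g ∈ M}` is a subgroup because `M` is `G`-stable and `φ(κ) ∈ (κ - 1)V ⊆ M` for
undetected `φ` —, hence `m·φ(t) ∈ M ∩ k·e_t = 0` and `φ(t) = 0` in characteristic zero.
With `M = ⊥` one recovers the frame theorem.  Everything is over a field of characteristic zero
and an arbitrary group; no named facts.
-/

-- `Summit.HodgeConjecture.HodgeConjecture.Theorems` is the mandated namespace (single-conjunct summit: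
-- Sub = Summit), which `linter.dupNamespace` flags on every declaration; the lakefile turns the
-- linter off tree-wide (weak option), restated here so stand-alone elaboration is warning-free too.
set_option linter.dupNamespace false

noncomputable section

open CategoryTheory groupCohomology
open Literature.AlgebraicGeometry.HodgeTheory

namespace Summit.HodgeConjecture.HodgeConjecture.Theorems

universe u

section General

variable {k G : Type u} [CommRing k] [Group G] (A : Rep k G)

/-- For a `1`-cocycle `φ` and a `G`-stable submodule `M`, the set `{g | φ g ∈ M}` is closed under
the group operations; hence if `φ` takes values in `M` on a set `s`, it does so on the subgroup
generated by `s`. [folklore] -/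
theorem localTubeSpan_cocycles₁_apply_mem_of_mem_closure (φ : cocycles₁ A) (M : Submodule k A.V)
    (hM : ∀ (g : G), ∀ v ∈ M, A.ρ g v ∈ M) (s : Set G)
    (hs : ∀ g ∈ s, (φ : G → A.V) g ∈ M) {g : G} (hg : g ∈ Subgroup.closure s) :
    (φ : G → A.V) g ∈ M := by
  induction hg using Subgroup.closure_induction with
  | mem g hg => exact hs g hg
  | one => rw [cocycles₁_map_one]; exact M.zero_mem
  | mul g h _ _ ihg ihh =>
      rw [(mem_cocycles₁_iff φ).1 φ.2 g h]
      exact M.add_mem (hM g _ ihh) ihg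
  | inv g _ ih =>
      have h1 : (φ : G → A.V) g⁻¹ = -(A.ρ g⁻¹ ((φ : G → A.V) g)) := by
        have := congrArg (A.ρ g⁻¹) (cocycles₁_map_inv φ g)
        rwa [Representation.inv_self_apply, map_neg] at this
      rw [h1]
      exact M.neg_mem (hM _ _ ih)

/-- An undetected cocycle (`φ κ ∈ (κ - 1)V` for all `κ`) takes values in `M` on every `κ` with
`(κ - 1)V ⊆ M`. [folklore] -/
theorem localTubeSpan_cocycles₁_apply_mem_of_subOneRange_le (φ : cocycles₁ A)
    (hφ : ∀ g : G, (φ : G → A.V) g ∈ subOneRange A g) (M : Submodule k A.V) {κ : G}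
    (hκ : subOneRange A κ ≤ M) : (φ : G → A.V) κ ∈ M :=
  hκ (hφ κ)

end General

section FrameMod

variable {k G : Type u} [Field k] [CharZero k] [Group G] (A : Rep k G)

/-- **Schnell's detection theorem, frame form modulo a stable submodule** (generalises
`localTubeSpan_injective_evalCoinv_of_frame`, [Schnell2010] Prop. 12).  Let `G` act on the
`k`-vector space `A` (`char k = 0`) and be generated by a set `s` of rank-one elements fixing their
direction (`(t - 1)A ⊆ k·e_t`, `t·e_t = e_t`).  Let `u_0, …, u_{r-1} ∈ G` be rank-one along
linearly independent vectors `δ_i`, and let `M` be a `G`-stable submodule with `k·e_t ∩ M = 0`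
for all `t ∈ s`.  If every `t ∈ s` has a positive power in the subgroup generated by the `u_i`
and all `κ ∈ G` with `(κ - 1)A ⊆ M`, then Schnell's third map `H¹(G, A) → ∏_g A/(g - 1)A` is
injective.  (In the crux: `M = R` the radical of the local vanishing lattice, `κ` ranging over
the kernel of `Γ_loc → GL(L)`.) [cite: Schnell2010, §7 Prop. 12 (proof) and §6 Lemma 9] -/
theorem localTubeSpan_injective_evalCoinv_of_frame_mod (s : Set G) (hs : Subgroup.closure s = ⊤)
    (e : G → A.V) (hse : ∀ t ∈ s, subOneRange A t ≤ k ∙ e t)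
    (hfix : ∀ t ∈ s, A.ρ t (e t) = e t) {r : ℕ} (u : Fin r → G) (δ : Fin r → A.V)
    (hδ : LinearIndependent k δ) (hu : ∀ i, subOneRange A (u i) ≤ k ∙ δ i)
    (M : Submodule k A.V) (hM : ∀ (g : G), ∀ v ∈ M, A.ρ g v ∈ M)
    (hMe : ∀ t ∈ s, (k ∙ e t) ⊓ M = ⊥)
    (hvirt : ∀ t ∈ s, ∃ m : ℕ, 0 < m ∧
      t ^ m ∈ Subgroup.closure (Set.range u ∪ {κ : G | subOneRange A κ ≤ M})) :
    Function.Injective (evalCoinv A) := by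
  refine (injective_iff_map_eq_zero _).2 fun ξ hξ => ?_
  induction ξ using H1_induction_on with
  | h φ₀ =>
  -- `φ₀` is undetected by every element
  have hund₀ : ∀ g : G, (φ₀ : G → A.V) g ∈ subOneRange A g := fun g => by
    have := congr_fun hξ g
    rwa [evalCoinv_H1π, Pi.zero_apply, Submodule.mkQ_apply, Submodule.Quotient.mk_eq_zero]
      at this
  -- the ordered products `P n = u_{n-1} ⋯ u_0` (with `u_i = 1` beyond `r`)
  let ub : ℕ → G := fun i => if h : i < r then u ⟨i, h⟩ else 1
  let P : ℕ → G := fun n => Nat.rec (motive := fun _ => G) 1 (fun i g => ub i * g) n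
  have hP0 : P 0 = 1 := rfl
  have hPsucc : ∀ n, P (n + 1) = ub n * P n := fun n => rfl
  have hub : ∀ i : Fin r, ub i = u i := fun i => by
    simp only [ub, dif_pos i.2]
  -- Step 1: adjust by a coboundary so that the cocycle vanishes at `P r`
  obtain ⟨v, hv⟩ := hund₀ (P r)
  set φ : cocycles₁ A := φ₀ - ⟨d₀₁ A v, d₀₁_apply_mem_cocycles₁ v⟩ with hφdef
  have hφapply : ∀ g, (φ : G → A.V) g = (φ₀ : G → A.V) g - (A.ρ g v - v) := fun g => by
    rw [hφdef]
    change (φ₀ : G → A.V) g - d₀₁ A v g = _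
    rw [d₀₁_hom_apply]
  have hund : ∀ g : G, (φ : G → A.V) g ∈ subOneRange A g :=
    localTubeSpan_undetected_sub_d₀₁ A φ₀ hund₀ v
  have hφPr : (φ : G → A.V) (P r) = 0 := by
    rw [hφapply, ← hv, LinearMap.sub_apply, LinearMap.id_apply, sub_self]
  -- it suffices to show that the adjusted cocycle vanishes identically
  suffices hall : ∀ g, (φ : G → A.V) g = 0 by
    rw [H1π_eq_zero_iff, mem_coboundaries₁_iff_exists]
    exact ⟨v, fun g => by have := hall g; rw [hφapply, sub_eq_zero] at this; exact this.symm⟩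
  -- the cocycle identity along the products
  have hcoc : ∀ n, (φ : G → A.V) (P (n + 1)) = A.ρ (ub n) ((φ : G → A.V) (P n)) +
      (φ : G → A.V) (ub n) := fun n => by
    rw [hPsucc, (mem_cocycles₁_iff φ).1 φ.2]
  -- Step 2 (Lemma 9): increments lie on the lines `k·δ_n`, partial values in the spans
  have hstep : ∀ (n : ℕ) (hn : n < r),
      (φ : G → A.V) (P (n + 1)) - (φ : G → A.V) (P n) ∈ k ∙ δ ⟨n, hn⟩ := fun n hn => by
    have e1 : (φ : G → A.V) (P (n + 1)) - (φ : G → A.V) (P n) =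
        (A.ρ (u ⟨n, hn⟩) ((φ : G → A.V) (P n)) - (φ : G → A.V) (P n)) +
          (φ : G → A.V) (u ⟨n, hn⟩) := by
      rw [hcoc n, ← hub ⟨n, hn⟩]
      abel
    rw [e1]
    exact Submodule.add_mem _ (hu ⟨n, hn⟩ ⟨_, rfl⟩) (hu ⟨n, hn⟩ (hund _))
  have hspan : ∀ n, n ≤ r →
      (φ : G → A.V) (P n) ∈ Submodule.span k (δ '' {i : Fin r | (i : ℕ) < n}) := by
    intro n
    induction n with
    | zero =>
        intro _
        rw [hP0, cocycles₁_map_one]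
        exact Submodule.zero_mem _
    | succ n ih =>
        intro hn
        have hn' : n < r := Nat.lt_of_succ_le hn
        have e1 : (φ : G → A.V) (P (n + 1)) =
            (φ : G → A.V) (P n) + ((φ : G → A.V) (P (n + 1)) - (φ : G → A.V) (P n)) := by abel
        rw [e1]
        refine Submodule.add_mem _ (Submodule.span_mono (Set.image_mono ?_) (ih hn'.le))
          (Submodule.span_mono ?_ (hstep n hn'))
        · intro i hi
          exact Nat.lt_succ_of_lt hi
        · rintro _ ⟨rfl⟩
          exact ⟨⟨n, hn'⟩, Nat.lt_succ_self n, rfl⟩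
  -- Step 3: peel off, using linear independence of the `δ_i`
  have hdown : ∀ (n : ℕ) (hn : n < r), (φ : G → A.V) (P (n + 1)) = 0 →
      (φ : G → A.V) (P n) = 0 := fun n hn h0 => by
    have hdisj : Disjoint (Submodule.span k (δ '' {i : Fin r | (i : ℕ) < n}))
        (Submodule.span k (δ '' {⟨n, hn⟩})) := by
      refine hδ.disjoint_span_image (Set.disjoint_left.2 ?_)
      rintro i hi rfl
      exact lt_irrefl n hi
    have hy : (φ : G → A.V) (P n) ∈ Submodule.span k (δ '' {i : Fin r | (i : ℕ) < n}) :=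
      hspan n hn.le
    have hx : -((φ : G → A.V) (P (n + 1)) - (φ : G → A.V) (P n)) ∈
        Submodule.span k (δ '' {⟨n, hn⟩}) := by
      rw [Set.image_singleton]
      exact Submodule.neg_mem _ (hstep n hn)
    rw [h0, zero_sub, neg_neg] at hx
    exact (Submodule.disjoint_def.1 hdisj) _ hy hx
  have hzeroP : ∀ m, m ≤ r → (φ : G → A.V) (P (r - m)) = 0 := by
    intro m
    induction m with
    | zero => intro _; simpa using hφPr
    | succ m ih =>
        intro hm
        have e1 : r - m = (r - (m + 1)) + 1 := by omega
        exact hdown _ (by omega) (e1 ▸ ih (Nat.le_of_succ_le hm))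
  have hzeroP' : ∀ n, n ≤ r → (φ : G → A.V) (P n) = 0 := fun n hn => by
    have := hzeroP (r - n) (Nat.sub_le r n)
    rwa [Nat.sub_sub_self hn] at this
  -- Step 4: the cocycle vanishes on the frame, hence takes values in `M` on the subgroup
  -- generated by the frame and the `κ` with `(κ - 1)A ⊆ M`
  have hu0 : ∀ i : Fin r, (φ : G → A.V) (u i) = 0 := fun i => by
    have := hcoc i
    rw [hzeroP' (i + 1) i.2, hzeroP' i i.2.le, map_zero, zero_add, hub] at this
    exact this.symm
  have hbig : ∀ g ∈ Subgroup.closure (Set.range u ∪ {κ : G | subOneRange A κ ≤ M}),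
      (φ : G → A.V) g ∈ M := fun g hg =>
    localTubeSpan_cocycles₁_apply_mem_of_mem_closure A φ M hM _ (by
      rintro g (⟨i, rfl⟩ | hκ)
      · rw [hu0 i]; exact M.zero_mem
      · exact localTubeSpan_cocycles₁_apply_mem_of_subOneRange_le A φ hund M hκ) hg
  -- Step 5: generators — `φ(t) = a·e_t`, `φ(t^m) = m·φ(t) ∈ M ∩ k·e_t = 0`, char 0
  have hgen : ∀ t ∈ s, (φ : G → A.V) t = 0 := fun t ht => by
    obtain ⟨a, ha⟩ := Submodule.mem_span_singleton.1 (hse t ht (hund t))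
    have hfixφ : A.ρ t ((φ : G → A.V) t) = (φ : G → A.V) t := by
      rw [← ha, map_smul, hfix t ht]
    obtain ⟨m, hm, hmem⟩ := hvirt t ht
    have h1 := localTubeSpan_cocycles₁_apply_pow_of_fix A φ t hfixφ m
    have hinM : (m : k) • (φ : G → A.V) t ∈ M := by rw [← h1]; exact hbig _ hmem
    have hinL : (m : k) • (φ : G → A.V) t ∈ k ∙ e t := by
      rw [← ha, smul_smul]
      exact Submodule.smul_mem _ _ (Submodule.mem_span_singleton_self _)
    have hzero : (m : k) • (φ : G → A.V) t = 0 := by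
      have : (m : k) • (φ : G → A.V) t ∈ (k ∙ e t) ⊓ M := ⟨hinL, hinM⟩
      rwa [hMe t ht, Submodule.mem_bot] at this
    have hm' : (m : k) ≠ 0 := Nat.cast_ne_zero.2 (Nat.pos_iff_ne_zero.1 hm)
    exact (smul_eq_zero.1 hzero).resolve_left hm'
  -- Step 6: everything
  intro g
  exact localTubeSpan_cocycles₁_apply_eq_zero_of_mem_closure A φ s hgen
    (by rw [hs]; exact Subgroup.mem_top g)

/-- The frame theorem modulo a stable submodule recovers the plain frame theorem (`M = ⊥`).
[cite: Schnell2010, §7 Prop. 12] -/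
theorem localTubeSpan_injective_evalCoinv_of_frame_mod_bot (s : Set G)
    (hs : Subgroup.closure s = ⊤)
    (e : G → A.V) (hse : ∀ t ∈ s, subOneRange A t ≤ k ∙ e t)
    (hfix : ∀ t ∈ s, A.ρ t (e t) = e t) {r : ℕ} (u : Fin r → G) (δ : Fin r → A.V)
    (hδ : LinearIndependent k δ) (hu : ∀ i, subOneRange A (u i) ≤ k ∙ δ i)
    (hvirt : ∀ t ∈ s, ∃ m : ℕ, 0 < m ∧
      t ^ m ∈ Subgroup.closure (Set.range u ∪ {κ : G | subOneRange A κ ≤ ⊥})) :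
    Function.Injective (evalCoinv A) :=
  localTubeSpan_injective_evalCoinv_of_frame_mod A s hs e hse hfix u δ hδ hu ⊥
    (fun g v hv => by rw [(Submodule.mem_bot k).1 hv, map_zero]; exact Submodule.zero_mem _)
    (fun _ _ => inf_bot_eq _) hvirt

end FrameMod

end Summit.HodgeConjecture.HodgeConjecture.Theorems

end
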